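import Summits.BirchSwinnertonDyer.BirchSwinnertonDyer.Theorems.EdixhovenFibreFiveSevenLTwistTransferAssembly
import Summits.BirchSwinnertonDyer.BirchSwinnertonDyer.Theorems.AdditiveKolyvaginRoadManinFrameResidueProperRAuxPrime
import HarnessLib
/-!
# AKR crux #7 `ManinFrameResidueProperR` from F″ ALONE (route `AdditiveKolyvaginRoad`, crux 20709, `--supports`)

Cell `pub/bsd-wall`, seat `bsd-wall-manin-p1` (prover, explicit-unit on AKR crux #7 stmt-BirchSwinnertonDyer-20709
`ManinFrameResidueProperR`, line `tame_twist`). THEOREMS ONLY (no definition, no named fact, no `sorry`). CONDITIONAL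
RESULT; the item stays open (it closes only if F″ is discharged) and BSD is not proved by this file.

State of the crux after this file: the registered skeleton (line `tame_twist`, v3) has stubs S57-T
(`stub_memberManinUnit_fiveSeven_torsion`) and F″ (`stub_katoNeronFiveLe`). With
* edix-p3's transfer assembly `LTwistTransfer.maninFrameResidueProperR_of_kato_of_transferWitness : F″ → hW″ → crux`
  (p594464; the Ihara-free L-TWIST `lTwist_of_transfer` by the transfer cycle, p594163), and
* this seat's `AuxPrime.transferWitness : hW″` (p59xxxx; the auxiliary prime by Chebotarev + the `GL₂(𝔽_p)` group
  theory `AuxPrime.exists_nonsquare_det_trace_ne`),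
the crux is a theorem GRANTED the single published, statement-only input
F″ = `Literature.NumberTheory.EllipticCurves.kato_neron_isIntegral_twistedSymbolSum_of_additive_five_le`
(Kato 2004 (8.1.3) / Thm 9.7 / Thm 6.6 with Kim–Nakamura 2020 Cor. 2.4; cite-only, XL formalisation target): NO Ihara
lemma (`diamondRibet1997_iharaLemma_sq` leaves the cone), NO cite-only Chebotarev, NO non-Eisenstein witness.

References: [Kato2004Asterisque] (8.1.3), Thm. 9.7, Thm. 6.6; [KimNakamura2020] Cor. 2.4; [TateGCFT1967] §2.4.
-/

set_option autoImplicit false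
-- the Theorems directory repeats the summit name (sibling precedent `SignedBaseChangeAssembly.lean`)
set_option linter.dupNamespace false

noncomputable section

open Literature.NumberTheory.EllipticCurves
  Summit.BirchSwinnertonDyer.BirchSwinnertonDyer.Theses.AdditiveKolyvaginRoad

namespace Summit.BirchSwinnertonDyer.BirchSwinnertonDyer.Theorems.ManinFrameResidueProperROfKatoLTwist

/-- **AKR crux #7 `ManinFrameResidueProperR` ⟸ F″ alone.** The transfer assembly
`LTwistTransfer.maninFrameResidueProperR_of_kato_of_transferWitness` (edix-p3 g3) fed with the PROVED transfer
witness `AuxPrime.transferWitness` (this seat). CONDITIONAL RESULT on the cite-only fact F″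
(`kato_neron_isIntegral_twistedSymbolSum_of_additive_five_le`); the item stays open; BSD is not proved by this.
[cite: Kato2004Asterisque, (8.1.3) (p. 180), Thm. 9.7 (p. 189)] [cite: KimNakamura2020, Cor. 2.4] -/
theorem maninFrameResidueProperR_of_kato
    (hK : kato_neron_isIntegral_twistedSymbolSum_of_additive_five_le) : ManinFrameResidueProperR :=
  LTwistTransfer.maninFrameResidueProperR_of_kato_of_transferWitness hK AuxPrime.transferWitness

end Summit.BirchSwinnertonDyer.BirchSwinnertonDyer.Theorems.ManinFrameResidueProperROfKatoLTwist

end
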